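import Summits.ResolutionOfSingularities.ResolutionOfSingularities.Theorems.FrobeniusClosingSteerSigmaTopLegalityOddDivisor
import HarnessLib

/-!
# Crux `Steer` (stmt-ResolutionOfSingularities-16345), chain W4.1: σ_top LEGALITY BRICKS, part 4 —
# «a CONE DIVISOR with few generators makes the stage NON-ISOLATED»: the `#T`-generator twin of (L6e), the
# binary-cone case (`p = 2`, base dimension `c ≥ 4`), and the char-2 normal form of an even binary form
# (res-L0-w41-idea-3 GEN 5, G1 of res-L0-w41-tri-3 TRIAGE R-P; res-L0-w41-plan-1 RULING 108b; Theses-free research support)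

OURS (campaign `res-hironaka`, rung L ★L-G4, slot W4.1; statements about the route's own objects; they replace the
role of no printed item and are NOT statements of the manuscript under review [claim: Hironaka2017, status:
under-review]; AI review is weaker than expert review). Seat res-L0-w41-idea-3 (planner; helper file
`--supports stmt-ResolutionOfSingularities-16345 --as helper`, counted 0). Part 3 is res-D-pv-004's
`FrobeniusClosingSteerSigmaTopLegalityOddDivisor.lean` ((L6a)–(L6f): `f = h² + x·G`, two generators, `c ≥ 3`); this
file generalises its (L6d)/(L6e) to any finite generating set `T ⊆ 𝔪` with `#T < dim R` and records the
three-generator instance that kills TANGENTIAL steps of the isolated constant-order game G-perf(4, 2e)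
(`NoEternalConstOrderIsolatedChainPerfect 2 4 (2e)`, the slate binder hG4) — see the seat's card
`Cruxes/Steer` evidence `idea-stripped-order-parity-slope.md` v1.3 § «GEN 5 — G1 ANSWER» for the informal Lemma B
(tangential step ⇒ binary cone) that feeds (CD2″).

## (CD) Cone divisors

* (CD0) **`not_hasIsolatedSingularity_of_sub_pow_mem_sq_span`** (any prime `p`): on a regular local member `R ⊆ K`
  (`K` of characteristic `p`) with `ringKrullDim R = c`, if `f − h^p ∈ (span T)²` for a finite `T ⊆ 𝔪` with
  `T.card < c`, then `R[X]/(X^p − f)` does NOT have an isolated singularity: a minimal prime `Q` over `T` has height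
  `≤ #T < c = ht 𝔪` (Krull, Mathlib `Ideal.height_le_card_of_mem_minimalPrimes_span_finset`), so `Q ≠ 𝔪`, and
  `f − h^p ∈ Q²` feeds res-type-096's (B1) `RadicandChain.exists_nonmaximal_not_isRegularLocalRing_of_sub_pow_mem_sq`.
  ((L6e) is the instance `T = {x, G}`, `3 ≤ c`.)
* (CD1) `not_hasIsolatedSingularity_of_binaryCone` (`p = 2`): `f = h² + x·A + σ·τ·H₀²` with `x, A, H₀ ∈ 𝔪` and
  `4 ≤ c` ⇒ not isolated (`T = {x, A, H₀}`: `f − h² = x·A + (στH₀)·H₀`).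
* (CD1′) `mem_maximalIdeal_of_binaryCone`: for `f = h² + x·A + B`, `x ∈ 𝔪 ∖ 𝔪²`, `B ∈ 𝔪²` and the stage SINGULAR at
  the centre in the form `∃ g, f − g² ∈ 𝔪²` (the `hmult` binder of the G-words at `p = 2`), `A ∈ 𝔪` — (L6a)'s argument.
* (CD1″) **`not_hasIsolatedSingularity_of_binaryCone'`**: chain-ready package — `f = h² + x·A + σ·τ·H₀²`,
  `x ∈ 𝔪 ∖ 𝔪²`, `H₀ ∈ 𝔪`, `∃ g, f − g² ∈ 𝔪²`, `4 ≤ c = ringKrullDim R` ⇒ not isolated (no hypothesis on `A, σ, τ`).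
* (CD2) `binaryForm_even_charTwo_eq`: in characteristic `2`,
  `Σ_i ρo_i²·σ^(2i+1)·τ^(2(e−1−i)+1) + Σ_i ρe_i²·σ^(2i)·τ^(2(e−i)) = σ·τ·(Σ_i ρo_i σ^i τ^(e−1−i))² + (Σ_i ρe_i σ^i τ^(e−i))²`
  — an even-degree binary form whose coefficients are squares (always true over a PERFECT residue field, lifting each
  coefficient as the square of a lift of its root) is `στ·H₀² + E²`; with `e ≥ 2`, `H₀ ∈ (σ, τ) ⊆ 𝔪`, which is the
  shape (CD1″) consumes.

WHY (informal, not typed here): in G-perf(4, 2e), `e ≥ 2`, the restricted radicand on the newest exceptional divisor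
`E = V(x)` is a polynomial of degree `≤ d` of cleaned order exactly `d`, hence `q² + C_d` with `C_d` a nonsquare cone
over the centre (res-L0-w41-strat-2 (B3) / res-type-026 `ConstOrder.exists_add_sq_of_forall_pderiv_free`); a
TANGENTIAL next centre imposes the cone condition again on `x̄ = 0`, making `C_d` BINARY mod squares, so by (CD2) the
stage has the shape of (CD1″) and is not isolated — contradiction; hence every step of the isolated game is
transversal and the exceptional parameter persists. No Theses file is imported; nothing here is a route item or a
registration. [cite: Matsumura1987, Thm. 14.2]
-/

noncomputable section

-- `Summit.<S>.<S>.…` duplicates the summit name by design (single-problem summit).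
set_option linter.dupNamespace false

open Polynomial IsLocalRing

namespace Summit.ResolutionOfSingularities.ResolutionOfSingularities.Theorems.SwitchingDichotomy.SigmaTopLegality

open Literature.AlgebraicGeometry.Resolution

variable {K : Type} [Field K]

/-! ## (CD0) The `#T`-generator non-isolatedness criterion -/

/-- **(CD0) `#T`-generator non-isolatedness.** On a regular local member `R ⊆ K` of characteristic `p` with
`dim R = c`: if `f − h^p ∈ (span T)²` for a finite `T ⊆ 𝔪` with `#T < c`, then `R[X]/(X^p − f)` does NOT have an
isolated singularity. OURS. [cite: Matsumura1987, Thm. 14.2] [folklore] -/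
theorem not_hasIsolatedSingularity_of_sub_pow_mem_sq_span (p : ℕ) [Fact p.Prime] [CharP K p]
    (R : Subring K) [IsRegularLocalRing R] (f h : R) (T : Finset R)
    (hT : ∀ t ∈ T, t ∈ maximalIdeal R) (hf : f - h ^ p ∈ Ideal.span (T : Set R) ^ 2)
    {c : ℕ} (hcard : T.card < c) (hdim : ringKrullDim R = c) :
    ¬ HasIsolatedSingularity (RadicandRing R p f) := by
  intro hiso
  have hle : Ideal.span (T : Set R) ≤ maximalIdeal R :=
    Ideal.span_le.mpr (fun t ht => hT t (by exact_mod_cast ht))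
  obtain ⟨Q, hQ, -⟩ := Ideal.exists_minimalPrimes_le hle
  haveI : Q.IsPrime := hQ.1.1
  have hQh : Q.height ≤ T.card := Ideal.height_le_card_of_mem_minimalPrimes_span_finset hQ
  have hne : Q ≠ maximalIdeal R := by
    intro hQm
    rw [hQm] at hQh
    have hm : ((maximalIdeal R).height : WithBot ℕ∞) = ((c : ℕ∞) : WithBot ℕ∞) := by
      rw [IsLocalRing.maximalIdeal_height_eq_ringKrullDim, hdim]; rfl
    have hm' : (maximalIdeal R).height = (c : ℕ∞) := WithBot.coe_injective hm
    rw [hm'] at hQh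
    have : c ≤ T.card := by exact_mod_cast hQh
    omega
  have hnotmax : ¬ Q.IsMaximal := fun hm => hne (IsLocalRing.eq_maximalIdeal hm)
  have hfQ : f - h ^ p ∈ Q ^ 2 := Ideal.pow_right_mono hQ.1.2 2 hf
  haveI : IsRegularRing R := isRegularRing_of_isRegularLocalRing R
  obtain ⟨P', hP', hlt, hreg⟩ :=
    RadicandChain.exists_nonmaximal_not_isRegularLocalRing_of_sub_pow_mem_sq (S := R) p f h Q hnotmax hfQ
  exact hreg (hiso P' hlt)

variable [CharP K 2]

/-- **(CD1) Binary cone ⇒ NOT isolated (`p = 2`, `c ≥ 4`).** On a regular local member `R ⊆ K` of characteristic `2`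
and dimension `c ≥ 4`: if `f = h² + x·A + σ·τ·H₀²` with `x, A, H₀ ∈ 𝔪` (`σ, τ` arbitrary), then `R[X]/(X² − f)` is
NOT isolated: `f − h² = x·A + (στH₀)·H₀ ∈ (x, A, H₀)²` and `#{x, A, H₀} ≤ 3 < c`. The shape is that of a stage whose
restricted radicand on the newest exceptional divisor `V(x)` is an even-degree BINARY form `R(σ,τ) = στH₀² + E²`
mod squares (`d ≥ 4 ⇒ H₀ ∈ 𝔪`). OURS. [cite: Matsumura1987, Thm. 14.2] [folklore] -/
theorem not_hasIsolatedSingularity_of_binaryCone (R : Subring K) [IsRegularLocalRing R]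
    (f h x A σ τ H₀ : R) (hf : f = h ^ 2 + x * A + σ * τ * H₀ ^ 2)
    (hx : x ∈ maximalIdeal R) (hA : A ∈ maximalIdeal R) (hH : H₀ ∈ maximalIdeal R)
    {c : ℕ} (hc : 4 ≤ c) (hdim : ringKrullDim R = c) :
    ¬ HasIsolatedSingularity (RadicandRing R 2 f) := by
  classical
  haveI : Fact (Nat.Prime 2) := ⟨Nat.prime_two⟩
  let T : Finset R := {x, A, H₀}
  have hT : ∀ t ∈ T, t ∈ maximalIdeal R := by
    intro t ht
    simp only [T, Finset.mem_insert, Finset.mem_singleton] at ht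
    rcases ht with rfl | rfl | rfl
    · exact hx
    · exact hA
    · exact hH
  have hxT : x ∈ Ideal.span (T : Set R) := Ideal.subset_span (by simp [T])
  have hAT : A ∈ Ideal.span (T : Set R) := Ideal.subset_span (by simp [T])
  have hHT : H₀ ∈ Ideal.span (T : Set R) := Ideal.subset_span (by simp [T])
  have hf' : f - h ^ 2 ∈ Ideal.span (T : Set R) ^ 2 := by
    have e : f - h ^ 2 = x * A + (σ * τ * H₀) * H₀ := by rw [hf]; ring
    rw [e, pow_two]
    exact Ideal.add_mem _ (Ideal.mul_mem_mul hxT hAT)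
      (Ideal.mul_mem_mul (Ideal.mul_mem_left _ _ hHT) hHT)
  have hcard : T.card < c := by
    have h3 : T.card ≤ 3 := by
      refine (Finset.card_insert_le _ _).trans ?_
      refine (Nat.succ_le_succ (Finset.card_insert_le _ _)).trans ?_
      rw [Finset.card_singleton]
    omega
  exact not_hasIsolatedSingularity_of_sub_pow_mem_sq_span 2 R f h T hT hf' hcard hdim

/-- **(CD1′) the hypothesis `A ∈ 𝔪` is automatic at a SINGULAR stage** (tri-1's (L6a) with one more harmless term): for a
regular local member `R` of characteristic `2`, `f = h² + x·A + B` with `x ∈ 𝔪 ∖ 𝔪²` and `B ∈ 𝔪²`: if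
`∃ g, f − g² ∈ 𝔪²` (the `hmult` binder of the G-words at `p = 2`: the stage is singular at the centre), then `A ∈ 𝔪`.
OURS. [cite: Matsumura1987, Thm. 14.2] [folklore] -/
theorem mem_maximalIdeal_of_binaryCone (R : Subring K) [IsRegularLocalRing R] (f h x A B : R)
    (hf : f = h ^ 2 + x * A + B) (hx : x ∈ maximalIdeal R) (hx2 : x ∉ maximalIdeal R ^ 2)
    (hB : B ∈ maximalIdeal R ^ 2) (hmult : ∃ g : R, f - g ^ 2 ∈ maximalIdeal R ^ 2) :
    A ∈ maximalIdeal R := by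
  by_contra hAu
  have hAunit : IsUnit A := of_not_not fun h' => hAu ((IsLocalRing.mem_maximalIdeal A).mpr h')
  obtain ⟨g, hg⟩ := hmult
  -- `f − g² = (h − g)² + x A + B` in characteristic 2
  have hsq : (h - g) ^ 2 = h ^ 2 - g ^ 2 := sub_pow_char h g
  have hdec : f - g ^ 2 = (h - g) ^ 2 + x * A + B := by rw [hsq, hf]; ring
  by_cases hhg : h - g ∈ maximalIdeal R
  · -- then `x A ∈ 𝔪²`, so `x ∈ 𝔪²`
    have hxA : x * A ∈ maximalIdeal R ^ 2 := by
      have : x * A = (f - g ^ 2) - (h - g) ^ 2 - B := by rw [hdec]; ring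
      rw [this]
      exact Ideal.sub_mem _ (Ideal.sub_mem _ hg (Ideal.pow_mem_pow hhg 2)) hB
    obtain ⟨u, hu⟩ := hAunit
    apply hx2
    have : x = x * A * ↑u⁻¹ := by rw [← hu, mul_assoc, Units.mul_inv, mul_one]
    rw [this]
    exact Ideal.mul_mem_right _ _ hxA
  · -- then `(h − g)²` is a unit lying in `𝔪`: absurd
    have hunit : IsUnit (h - g) := of_not_not fun h' => hhg ((IsLocalRing.mem_maximalIdeal _).mpr h')
    have hmem : (h - g) ^ 2 ∈ maximalIdeal R := by
      have : (h - g) ^ 2 = (f - g ^ 2) - x * A - B := by rw [hdec]; ring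
      rw [this]
      refine Ideal.sub_mem _ (Ideal.sub_mem _ (Ideal.pow_le_self two_ne_zero hg)
        (Ideal.mul_mem_right _ _ hx)) (Ideal.pow_le_self two_ne_zero hB)
    exact (IsLocalRing.mem_maximalIdeal _).mp hmem (hunit.pow 2)

/-- **(CD1″) packaged for the chain**: `f = h² + x·A + σ·τ·H₀²` with `x ∈ 𝔪 ∖ 𝔪²`, `H₀ ∈ 𝔪` (`σ, τ, A`
arbitrary), the stage singular at the centre (`∃ g, f − g² ∈ 𝔪²`, = the `hmult` binder at `p = 2`) and
`dim R = c ≥ 4` ⇒ NOT isolated (no hypothesis on `A`). OURS. [cite: Matsumura1987, Thm. 14.2] [folklore] -/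
theorem not_hasIsolatedSingularity_of_binaryCone' (R : Subring K) [IsRegularLocalRing R]
    (f h x A σ τ H₀ : R) (hf : f = h ^ 2 + x * A + σ * τ * H₀ ^ 2)
    (hx : x ∈ maximalIdeal R) (hx2 : x ∉ maximalIdeal R ^ 2) (hH : H₀ ∈ maximalIdeal R)
    (hmult : ∃ g : R, f - g ^ 2 ∈ maximalIdeal R ^ 2)
    {c : ℕ} (hc : 4 ≤ c) (hdim : ringKrullDim R = c) :
    ¬ HasIsolatedSingularity (RadicandRing R 2 f) := by
  have hB : σ * τ * H₀ ^ 2 ∈ maximalIdeal R ^ 2 := by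
    rw [pow_two (maximalIdeal R), pow_two H₀]
    exact Ideal.mul_mem_left _ _ (Ideal.mul_mem_mul hH hH)
  have hA : A ∈ maximalIdeal R :=
    mem_maximalIdeal_of_binaryCone R f h x A (σ * τ * H₀ ^ 2) hf hx hx2 hB hmult
  exact not_hasIsolatedSingularity_of_binaryCone R f h x A σ τ H₀ hf hx hA hH hc hdim

/-- **(CD2) char-2 normal form of an EVEN-degree binary form with square coefficients** (the bridge from the informal
Lemma B «tangential ⇒ binary cone» to (CD1″)'s shape): in characteristic `2`, for `σ, τ` and coefficient square roots `ρo` (odd part) and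
`ρe` (even part), `Σ_i ρo_i²·σ^(2i+1)·τ^(2(e−1−i)+1) + Σ_i ρe_i²·σ^(2i)·τ^(2(e−i)) = σ·τ·H₀² + E²` with
`H₀ = Σ_i ρo_i σ^i τ^(e−1−i)` and `E = Σ_i ρe_i σ^i τ^(e−i)` (Frobenius is additive). Over a PERFECT residue field
every coefficient of the cone is a square, and lifting each coefficient as the square of a lift of its root puts a
stage with binary restricted cone EXACTLY in the shape of (CD1″) (the discrepancy is a multiple of the exceptional
parameter `x`, absorbed in `x·A`). OURS. [folklore] -/
theorem binaryForm_even_charTwo_eq {A : Type*} [CommRing A] [CharP A 2] (σ τ : A) (e : ℕ)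
    (ρo : Fin e → A) (ρe : Fin (e + 1) → A) :
    (∑ i, ρo i ^ 2 * σ ^ (2 * (i : ℕ) + 1) * τ ^ (2 * (e - 1 - i) + 1)) +
      (∑ i, ρe i ^ 2 * σ ^ (2 * (i : ℕ)) * τ ^ (2 * (e - i))) =
    σ * τ * (∑ i, ρo i * σ ^ (i : ℕ) * τ ^ (e - 1 - i)) ^ 2 +
      (∑ i, ρe i * σ ^ (i : ℕ) * τ ^ (e - i)) ^ 2 := by
  rw [sum_pow_char 2, sum_pow_char 2, Finset.mul_sum]
  congr 1
  · refine Finset.sum_congr rfl (fun i _ => ?_)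
    ring
  · refine Finset.sum_congr rfl (fun i _ => ?_)
    ring

end Summit.ResolutionOfSingularities.ResolutionOfSingularities.Theorems.SwitchingDichotomy.SigmaTopLegality
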